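import Summits.Langlands.Langlands.Theses.EmbeddingNecklace
import Literature.NumberTheory.GaloisRepresentations.IntegralGaloisAction

/-!
# Birth skeleton (BC3) for crux stmt-Langlands-18133
`Summit.Langlands.Langlands.Theses.EmbeddingNecklace.DeRhamLiftingRed` — line `birth`

Route `route-Langlands-EmbeddingNecklace` (rev 3; `closes hI hR hA hC := hC (hA hI hR) : Langlands`).
The crux (rank 5) is the residually-REDUCIBLE-above-`p` sector of the route's typed target
`DeRhamLiftingUnramified`: for `F` totally real, `p ≥ 5` unramified in `F`, every continuous irreducible,
totally odd, a.e. unramified `ρ : Γ_F → GL₂(ℚ̄_p)`, de Rham with two distinct `τ`-labelled Hodge–Tate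
weights at every `v ∣ p` (Fontaine's pinned datum), residually reducible at SOME `v ∣ p` (trace-congruent
on `Γ_{F_v}` to `χ₁ + χ₂`, `χ_i` of finite order), with `ρ̄|_{F(ζ_p)}` absolutely irreducible (trace
rendering) and `ρ̄` modular, is attached a.e. to a regular L-algebraic cuspidal `π` of `GL₂(𝔸_F)`.

## The line: the route header's own REGIME DECOMPOSITION by residue degree above `p`
(route file, TWO-LAYER PLAN: "DeRhamLiftingRed ⇐ RedLowDegree (all f_v ≤ 2: Kisin/Hu–Tan/Matsumoto
modulo the non-generic corner) → RedHighDegree (some f_v ≥ 3) → DeRhamLiftingRed"), with the low-degree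
regime cut once more so that the regime that is IN PRINT (p totally split) is its own named stub.  Since
`p ∤ d_F`, every `v ∣ p` is unramified and `q_v = v.residueCard = p^{f_v}` (`residueCard := Ideal.absNorm`,
the rendering of "p splits completely" in `HuTan2015_theorem63` / `Tung2021_hilbertTotallySplit`), so
`f_v = 1 ⟺ q_v = p`, `f_v ≤ 2 ⟺ q_v ≤ p²`, `f_v ≥ 3 ⟺ p² < q_v`; the three regimes below are stated
with exactly these inequalities and are mutually exclusive and exhaustive by pure logic (no arithmetic of
`q_v` is used in the composition).  Each regime is owned by a different engine:

* `stub_redSplit` — regime `q_v = p` for every `v ∣ p` (p totally split).  IN PRINT: Kisin 2009 Thm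
  (2.2.18) + Paškūnas 2015 / Hu–Tan 2015 Thm 6.3 (the excluded residual shape `(ωχ *; 0 χ)` at
  `F_v = ℚ_p`, `p ≥ 5`) for all potentially semistable types = Tung 2021 Thm 4.5, vendored as the named
  fact `Literature.NumberTheory.Automorphic.Tung2021_hilbertTotallySplit` (conclusion UP TO TWIST, residual
  bigness as `.IsResiduallyAbsIrreducible`, labels `τ : F_v →+* ℚ̄_p` continuous with `Nodup`).  Closing it
  in-tree = `(h : Tung2021_hilbertTotallySplit) →` this regime, via three bridges: (i) trace rendering of
  "`ρ̄|_{F(ζ_p)}` absolutely irreducible" ⟹ `IsResiduallyAbsIrreducible` (Brauer–Nesbitt, `p > 2`);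
  (ii) `ℚ_p`-algebra labels with `Nodup ∧ card = 2` ⟹ continuous ring-hom labels with `Nodup`;
  (iii) UNTWISTING: `ρ` and `ρ ⊗ χ` both de Rham ⟹ `χ` de Rham ⟹ (F totally real) `χ = ψ · ε^m`, `ψ` of
  finite order, so `π ⊗ (ψ⁻¹|·|^{-m} ∘ Art)` is cuspidal, L-algebraic, regular, attached a.e. to `ρ` —
  needs a twist operation on `CuspidalAutomorphicRepData` compatible with `SatakeFrobCompatibleAE`
  (vocabulary work).  Size: L (M if the untwisting carrier lands first).  The residual place being
  reducible plays no role here (Tung covers every residual shape at split `p ≥ 5`).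
* `stub_redLowDegree` — regime `q_v ≤ p²` for every `v ∣ p` and `q_v ≠ p` for some `v ∣ p` (all residue
  degrees ≤ 2, at least one quadratic place).  PARTLY IN PRINT: Matsumoto 2025 (arXiv:2512.04641) Thm 1.2
  — `F_v ∈ {ℚ_p, ℚ_{p²}}` for all `v ∣ p`, `p ≥ 5`, arbitrary de Rham HT-regular `ρ`, residually
  modular with `ρ̄|_{F(ζ_p)}` abs. irreducible, under the Serre-weight GENERICITY window
  `2 ≤ k_{τ,1} − k_{τ,2} ≤ p − 5` at the quadratic places (p0004 of the held text; grounder notes on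
  stmt-Langlands-18132/18133) — which covers generic reducible `ρ̄_v` (split or non-split) and EXCLUDES
  exactly the non-generic reducible corner `χ₁χ₂⁻¹|_{Γ_{F_v}} ∈ {1, ω^{±1}}` named in the crux's
  why-it-might-fail.  OPEN on that corner at `f_v = 2` (no Paškūnas/Hu–Tan analogue for `GL₂(ℚ_{p²})`:
  barrier `ModPLanglandsGL2BeyondQpFpBar`); the route's necklace (|Ψ| ≤ 2 beads = Matsumoto's own
  U(1,1)-surfaces) is the intended engine on the generic part, `NonGenericResidue` (stmt-Langlands-18142)
  the conceded remainder.  Size: XL / open-problem on the corner.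
* `stub_redHighDegree` — regime `p² < q_v` for some `v ∣ p` (a place of residue degree ≥ 3).  OPEN
  (nothing in print beyond Jiang 2026 arXiv:2605.18426 Thm 1.1.4: p inert, PARALLEL weight, split-generic
  `ρ̄_p`): this is the necklace's proper regime — BigRTEigenvector (BHHMS / Hu–Wang GK-dimension at
  unramified `v`, GeeNewton2020) + NecklaceClosure over an ordering of the `f_v ≥ 3` embeddings +
  LocallyAlgebraicClassical (informal items stmt-Langlands-18136–18141).  Note the regime still contains
  fields with OTHER places of degree ≤ 2 above `p`; the necklace runs place by place.  Size: open-problem.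

None of the three is the crux or the summit in costume: each is the crux restricted to a proper
sub-family of pairs `(F, p)` (BC3 probes `stub → DeRhamLiftingRed`, `stub → Langlands` by
`first | exact? | simpa | aesop` FAIL for all three — files `bc/probe_*.lean` of the registering session,
verdicts quoted in `Lines/birth.md`); conversely `DeRhamLiftingRed → stub` is trivial for each (they are
regimes), which is the intended direction of use.  The composition `DeRhamLiftingRed_of` is the exhaustion
`(∀ v∣p, q_v = p) ∨ (∀ v∣p, q_v ≤ p²) ∧ (∃ v∣p, q_v ≠ p) ∨ (∃ v∣p, p² < q_v)` — pure logic (`by_cases`,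
`push Not`), kernel-checked, no `sorry`; it concludes the route decl BY NAME.

Shape (for `ledger skeleton check` / `#h21_check_skeleton`): `RedLiftingAt F p` is the crux body at fixed
`(F, p)` (verbatim; `deRhamLiftingRed_iff` is `Iff.rfl`); the three regimes are the closed `def`s `RedSplit`,
`RedLowDegree`, `RedHighDegree : Prop`; each stub is `theorem stub_<name> : <its regime, written out> := by sorry`;
the composition `DeRhamLiftingRed_of` takes the three stub statements as hypotheses through the name-keyed
aliases `__Registered.stub_<name>` (an `abbrev` for the regime def, short name = the stub's name — the device of
`Cruxes/CleanRoomInjectionFloor/Lines/birth.lean`: the native audit admits a hypothesis of the composing theorem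
only if its head constant is a registered obligation or is NAMED like a declared stub, and crux workfiles may not
carry the gate-reserved `@[stub]` tag) and concludes the route decl BY NAME; the closing `example` feeds the three
sorried stubs to it (definitional unfolding only).  Sorries: exactly three, one per stub, none elsewhere.

Disproof used: none on file — `ledger crux ls stmt-Langlands-18133` shows no workfiles (no Disproof.lean,
no Negative lemma, no dead line) at registration time 2026-08-17.  Negatives index (`ledger negatives
--problem Langlands`, 4 entries: SplitPrimeInduction ×2, OrdinaryPrimeTransport RankinSelbergPoleCount,
K3KugaSatakeDescent SerreTypeAnchor): none concerns GL₂ automorphy lifting at p, so no stub instantiates a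
refuted statement.  Item evidence read: refuter birth-attack (Probe.lean: `red_of_target`, `summit_gives_AE`
— the crux is S-sector + regular-weight clause, not S) and grounder notes g85-0/1/2 (page-level status of
the three regimes, used above).
-/

set_option linter.dupNamespace false
set_option linter.unusedVariables false
set_option autoImplicit false

namespace Summit.Langlands.Langlands.Cruxes.DeRhamLiftingRed.Birth

open scoped NumberField
open Filter
open IsDedekindDomain (HeightOneSpectrum)
open Summit.Langlands.Langlands.Theses.EmbeddingNecklace (DeRhamLiftingRed)

/-! ## 0. The crux body at a fixed field and prime -/

/-- `RedLiftingAt F p`: the body of the crux `DeRhamLiftingRed` at a fixed number field `F` and prime `p`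
(VERBATIM the crux after its binders `F`, `IsTotallyReal F`, `p`, `5 ≤ p`, `p ∤ d_F`): every continuous
irreducible, a.e. unramified, totally odd `ρ : Γ_F → GL₂(ℚ̄_p)`, de Rham with two distinct labelled
Hodge–Tate weights at every `v ∣ p`, residually reducible at some `v ∣ p`, residually absolutely
irreducible over `F(ζ_p)` and residually modular, is attached a.e. to a regular L-algebraic cuspidal `π`.
[cite: Kisin2009, Thm. (2.2.18)] [cite: HuTan2015, Thm. 6.3] -/
def RedLiftingAt (F : Type) [Field F] [NumberField F] (p : ℕ) [Fact p.Prime] : Prop :=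
  ∀ (hcpt : Literature.NumberTheory.Automorphic.isCompact_glFiniteIntegralLevel 2 F) (ι : PadicAlgCl p ≃+* ℂ) (ρ : Literature.NumberTheory.GaloisRepresentations.FramedGaloisRep F (PadicAlgCl p) 2), ρ.toGaloisRep.IsIrreducible →
    (∀ᶠ v : IsDedekindDomain.HeightOneSpectrum (NumberField.RingOfIntegers F) in Filter.cofinite, ρ.IsUnramifiedAt v) → ρ.IsOdd →
    (∀ (v : IsDedekindDomain.HeightOneSpectrum (NumberField.RingOfIntegers F)) (hv : ((p : ℕ) : NumberField.RingOfIntegers F) ∈ v.asIdeal), let D := Literature.NumberTheory.PAdicHodge.fontainePstAdicCompletion v p hv; D.IsDeRhamFramed (ρ.toLocal v) ∧ (letI := D.algebra; ∀ τ : v.adicCompletion F →ₐ[ℚ_[p]] PadicAlgCl p, let M := ρ.labelledHodgeTateWeightsAt v D.algebra D.𝔅 τ.toRingHom; M.Nodup ∧ Multiset.card M = 2)) →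
    (∃ v : IsDedekindDomain.HeightOneSpectrum (NumberField.RingOfIntegers F), ((p : ℕ) : NumberField.RingOfIntegers F) ∈ v.asIdeal ∧ ∃ χ₁ χ₂ : Field.absoluteGaloisGroup (v.adicCompletion F) →* (PadicAlgCl p)ˣ, IsOpen (χ₁.ker : Set (Field.absoluteGaloisGroup (v.adicCompletion F))) ∧ IsOpen (χ₂.ker : Set (Field.absoluteGaloisGroup (v.adicCompletion F))) ∧ ∀ σ, ‖(ρ.toLocal v σ).val.trace - ((χ₁ σ : PadicAlgCl p) + (χ₂ σ : PadicAlgCl p))‖ < 1) →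
    (¬ ∃ χ₁ χ₂ : Field.absoluteGaloisGroup (CyclotomicField p F) →* (PadicAlgCl p)ˣ, IsOpen (χ₁.ker : Set (Field.absoluteGaloisGroup (CyclotomicField p F))) ∧ IsOpen (χ₂.ker : Set (Field.absoluteGaloisGroup (CyclotomicField p F))) ∧ ∀ σ, ‖(ρ.restrictField (CyclotomicField p F) σ).val.trace - ((χ₁ σ : PadicAlgCl p) + (χ₂ σ : PadicAlgCl p))‖ < 1) →
    (∃ (π₀ : Literature.NumberTheory.Automorphic.CuspidalAutomorphicRepData 2 F hcpt) (ρ₀ : Literature.NumberTheory.GaloisRepresentations.FramedGaloisRep F (PadicAlgCl p) 2), π₀.1.IsLAlgebraic ∧ (∃ T : Literature.NumberTheory.Automorphic.InfinityType F 2, π₀.1.HasInfinityType T ∧ T.IsRegular) ∧ Literature.NumberTheory.Automorphic.SatakeFrobCompatibleAE ι π₀.1 ρ₀ ∧ ∀ σ, ‖(ρ σ).val.trace - (ρ₀ σ).val.trace‖ < 1) →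
    ∃ π : Literature.NumberTheory.Automorphic.CuspidalAutomorphicRepData 2 F hcpt, π.1.IsLAlgebraic ∧ (∃ T : Literature.NumberTheory.Automorphic.InfinityType F 2, π.1.HasInfinityType T ∧ T.IsRegular) ∧ Literature.NumberTheory.Automorphic.SatakeFrobCompatibleAE ι π.1 ρ

/-- The crux is `RedLiftingAt` quantified over totally real `F` and unramified `p ≥ 5` (definitional). -/
theorem deRhamLiftingRed_iff :
    DeRhamLiftingRed ↔
      ∀ (F : Type) [Field F] [NumberField F], NumberField.IsTotallyReal F → ∀ (p : ℕ) [Fact p.Prime],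
        5 ≤ p → ¬ ((p : ℤ) ∣ NumberField.discr F) → RedLiftingAt F p :=
  Iff.rfl

/-! ## 1. The three regime statements (closed `Prop`s) -/

/-- **Regime 1 — `p` totally split in `F`** (`q_v = p` for every `v ∣ p`; with `p ∤ d_F` this is
"`p` splits completely", the rendering of `HuTan2015_theorem63` / `Tung2021_hilbertTotallySplit`):
the crux for such `(F, p)`.  In print (Kisin 2009 (2.2.18) + Paškūnas 2015 + Hu–Tan 2015 6.3 = Tung 2021
Thm 4.5, all potentially semistable types, every residual shape at `v ∣ p`, `p ≥ 5`); in-tree route to it: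
`Tung2021_hilbertTotallySplit →` this, via the residual-bigness and label bridges and UNTWISTING of the
conclusion (see module docstring).  Size L.
[cite: Tung2021, Thm. 4.5] [cite: Kisin2009, Thm. (2.2.18)] [cite: HuTan2015, Thm. 6.3]
[cite: Paskunas2015, Thm. 1.1] -/
def RedSplit : Prop :=
  ∀ (F : Type) [Field F] [NumberField F], NumberField.IsTotallyReal F → ∀ (p : ℕ) [Fact p.Prime],
    5 ≤ p → ¬ ((p : ℤ) ∣ NumberField.discr F) →
    (∀ v : HeightOneSpectrum (𝓞 F), ((p : ℕ) : 𝓞 F) ∈ v.asIdeal → v.residueCard = p) →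
    RedLiftingAt F p

/-- **Regime 2 — all residue degrees above `p` at most 2, at least one place not of degree 1**
(`q_v ≤ p²` for every `v ∣ p`, `q_v ≠ p` for some `v ∣ p`): the crux for such `(F, p)`.  Generic part in
print (Matsumoto 2025 Thm 1.2: `F_v ∈ {ℚ_p, ℚ_{p²}}` ∀ `v ∣ p`, Serre weights of `ρ̄_v` in the window
`[2, p − 5]` at the quadratic places); OPEN on the non-generic reducible corner `χ₁χ₂⁻¹ ∈ {1, ω^{±1}}`
at a quadratic place (the route concedes it as `NonGenericResidue`).  Size XL / open on the corner.
[cite: Matsumoto2025, Thm. 1.2 and Rem. 1.3(1)] [cite: HuTan2015, Thm. 6.3] -/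
def RedLowDegree : Prop :=
  ∀ (F : Type) [Field F] [NumberField F], NumberField.IsTotallyReal F → ∀ (p : ℕ) [Fact p.Prime],
    5 ≤ p → ¬ ((p : ℤ) ∣ NumberField.discr F) →
    (∀ v : HeightOneSpectrum (𝓞 F), ((p : ℕ) : 𝓞 F) ∈ v.asIdeal → v.residueCard ≤ p ^ 2) →
    (∃ v : HeightOneSpectrum (𝓞 F), ((p : ℕ) : 𝓞 F) ∈ v.asIdeal ∧ v.residueCard ≠ p) →
    RedLiftingAt F p

/-- **Regime 3 — some place above `p` of residue degree ≥ 3** (`p² < q_v` for some `v ∣ p`): the crux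
for such `(F, p)`.  OPEN — the necklace's proper regime (beads `S_Ψ`, `|Ψ| ≤ 2`, over an ordering of the
`f_v` embeddings; eigenvector existence from BHHMS / Hu–Wang GK-dimension + Gee–Newton; classicality of
locally algebraic vectors); in print only Jiang 2026 Thm 1.1.4 (p inert, parallel weight, split-generic).
Size: open-problem.
[cite: Jiang2026, Thm. 1.1.4 and Rem. 1.1.3] [cite: Matsumoto2025, Conj. 1.13 and Rem. 1.15]
[cite: QiuSu2025, Conj. 2.1.2] [cite: GeeNewton2020, §5] -/
def RedHighDegree : Prop :=
  ∀ (F : Type) [Field F] [NumberField F], NumberField.IsTotallyReal F → ∀ (p : ℕ) [Fact p.Prime],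
    5 ≤ p → ¬ ((p : ℤ) ∣ NumberField.discr F) →
    (∃ v : HeightOneSpectrum (𝓞 F), ((p : ℕ) : 𝓞 F) ∈ v.asIdeal ∧ p ^ 2 < v.residueCard) →
    RedLiftingAt F p

/-! ## 2. The stubs (registered obligations; `sorry` lives here and only here) -/

/-- STUB 1 = `RedSplit` written out (regime `p` totally split; in print, Tung 2021 Thm 4.5 up to twist —
size L in-tree).  [cite: Tung2021, Thm. 4.5] [cite: HuTan2015, Thm. 6.3] -/
theorem stub_redSplit :
    ∀ (F : Type) [Field F] [NumberField F], NumberField.IsTotallyReal F → ∀ (p : ℕ) [Fact p.Prime],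
      5 ≤ p → ¬ ((p : ℤ) ∣ NumberField.discr F) →
      (∀ v : HeightOneSpectrum (𝓞 F), ((p : ℕ) : 𝓞 F) ∈ v.asIdeal → v.residueCard = p) →
      RedLiftingAt F p := by
  sorry

/-- STUB 2 = `RedLowDegree` written out (regime all `f_v ≤ 2`, some `f_v = 2`; generic part Matsumoto 2025
Thm 1.2, non-generic reducible corner open).  [cite: Matsumoto2025, Thm. 1.2] -/
theorem stub_redLowDegree :
    ∀ (F : Type) [Field F] [NumberField F], NumberField.IsTotallyReal F → ∀ (p : ℕ) [Fact p.Prime],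
      5 ≤ p → ¬ ((p : ℤ) ∣ NumberField.discr F) →
      (∀ v : HeightOneSpectrum (𝓞 F), ((p : ℕ) : 𝓞 F) ∈ v.asIdeal → v.residueCard ≤ p ^ 2) →
      (∃ v : HeightOneSpectrum (𝓞 F), ((p : ℕ) : 𝓞 F) ∈ v.asIdeal ∧ v.residueCard ≠ p) →
      RedLiftingAt F p := by
  sorry

/-- STUB 3 = `RedHighDegree` written out (regime some `f_v ≥ 3`; open — the necklace's regime).
[cite: Jiang2026, Rem. 1.1.3] [cite: Matsumoto2025, Rem. 1.15] -/
theorem stub_redHighDegree :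
    ∀ (F : Type) [Field F] [NumberField F], NumberField.IsTotallyReal F → ∀ (p : ℕ) [Fact p.Prime],
      5 ≤ p → ¬ ((p : ℤ) ∣ NumberField.discr F) →
      (∃ v : HeightOneSpectrum (𝓞 F), ((p : ℕ) : 𝓞 F) ∈ v.asIdeal ∧ p ^ 2 < v.residueCard) →
      RedLiftingAt F p := by
  sorry

/-! ## 2b. Name-keyed aliases of the three stub statements — the hypotheses of `DeRhamLiftingRed_of`

The native skeleton audit (`#h21_check_skeleton`, run by `ledger skeleton check`) admits a hypothesis of the
composing theorem only if its head constant is a registered obligation or is NAMED like a declared stub;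
`__Registered.stub_X` is the statement of `stub_X` (the regime def, definitionally) under the stub's short
name (device of `Cruxes/CleanRoomInjectionFloor/Lines/birth.lean`; the `__` namespace is an implementation
detail invisible to the stub report). -/
namespace __Registered

/-- Alias of the statement of `stub_redSplit` (= `RedSplit`), keyed by the stub name. -/
abbrev stub_redSplit : Prop := RedSplit

/-- Alias of the statement of `stub_redLowDegree` (= `RedLowDegree`), keyed by the stub name. -/
abbrev stub_redLowDegree : Prop := RedLowDegree

/-- Alias of the statement of `stub_redHighDegree` (= `RedHighDegree`), keyed by the stub name. -/
abbrev stub_redHighDegree : Prop := RedHighDegree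

end __Registered

/-! ## 3. The composition (kernel-checked, no `sorry`): the three regimes exhaust all `(F, p)` -/

/-- **`DeRhamLiftingRed` from the three regime stubs.**  Fix `F, p` with the crux's hypotheses.  Either
every `v ∣ p` has `q_v = p` (regime 1), or every `v ∣ p` has `q_v ≤ p²` but some has `q_v ≠ p`
(regime 2), or some `v ∣ p` has `p² < q_v` (regime 3) — excluded middle twice; in each case the
corresponding stub gives `RedLiftingAt F p`, which is the crux at `(F, p)` by `deRhamLiftingRed_iff`.
Hypotheses = the three stub statements (name-keyed aliases `__Registered.stub_*`); conclusion = the route decl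
BY NAME. [folklore] -/
theorem DeRhamLiftingRed_of (h₁ : __Registered.stub_redSplit) (h₂ : __Registered.stub_redLowDegree)
    (h₃ : __Registered.stub_redHighDegree) : DeRhamLiftingRed := by
  dsimp only [__Registered.stub_redSplit, __Registered.stub_redLowDegree,
    __Registered.stub_redHighDegree] at h₁ h₂ h₃
  intro F _ _ hF p _ hp hdisc
  by_cases hs : ∀ v : HeightOneSpectrum (𝓞 F), ((p : ℕ) : 𝓞 F) ∈ v.asIdeal → v.residueCard = p
  · exact h₁ F hF p hp hdisc hs
  by_cases hl : ∀ v : HeightOneSpectrum (𝓞 F), ((p : ℕ) : 𝓞 F) ∈ v.asIdeal → v.residueCard ≤ p ^ 2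
  · push Not at hs
    exact h₂ F hF p hp hdisc hl hs
  · push Not at hl
    exact h₃ F hF p hp hdisc hl

/-- By-name sanity check (an `example`, not a declaration): the three stubs feed the composition as
they stand, so the hypotheses of `DeRhamLiftingRed_of` are literally the stub statements. -/
example : DeRhamLiftingRed :=
  DeRhamLiftingRed_of stub_redSplit stub_redLowDegree stub_redHighDegree

end Summit.Langlands.Langlands.Cruxes.DeRhamLiftingRed.Birth
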